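import Mathlib.Probability.Moments.Variance
import Mathlib.Dynamics.Ergodic.MeasurePreserving
import HarnessLib

/-!
# FK-continuity cell, FO-10a: the `L²` law of large numbers for translation averages under an invariant measure
# that is mixing along `|v| → ∞` (the step "by the ergodic theorem" of Grimmett 2006, §4.5 (4.83))

Registered R111 (cell INBOX l.7597, 2026-08-25); registry row FO-10a-g342; label LLN-A (coordinator fk-4 g228).
Cell `fk-continuity` (bschramm), row FO-10a (pressure layer); support file for the FK-continuity transplant
(`--supports stmt-CriticalPhenomena-4575`); builds on p205010 (kernel theorem, internal audit signed; external expert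
review pending). Pure proofs; no definitions, no named facts, no sorries. GENERIC measure theory: a probability measure
`P` on `Ω` and an additive commutative group `G` acting on `Ω` by measurable `P`-preserving maps `T v`
(`T w ∘ T v = T (v + w)`). UNCONDITIONAL; it decides nothing about FH / TP_FK / the value of `p_c(q)`. The companion
`TranslationAveragesFK.lean` instantiates it with the translations of `ℤ^d` acting on bond configurations and
`P = φ^b_{p,q}`, whose mixing on local events along `|v| → ∞` (Grimmett 2006 Cor. (4.23)) is the tree's
`IsBoxLimit.tendsto_real_inter_preimage_shift_cofinite`.

Grimmett 2006 obtains (4.83), `k(ω,Λ_n)/|Λ_n| → κ` `φ`-a.s., from the multiparameter ergodic theorem, which the tree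
does not hold. This file proves the `L²` / `L¹` / in-probability law of large numbers replacing it, from MIXING OF THE
EVENT WITH ITS OWN TRANSLATES ONLY, along ANY finite sets `Λ_i ⊆ G` with `|Λ_i| → ∞` (no box geometry, no van Hove
condition):

* `measureReal_preimage_inter_preimage` — `P(T_x⁻¹A ∩ T_y⁻¹A) = P(A ∩ T_{y−x}⁻¹A)`; `abs_sum_sum_sub_le_card_mul` — the
  double-sum estimate `|Σ_{x,y∈Λ} c(y − x)| ≤ |Λ| (|V| M + |Λ| ε)` (`|c| ≤ M`, and `|c| ≤ ε` off the finite `V`);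
* `integral_sq_avg_indicator_sub_eq` — `∫ (|Λ|⁻¹ Σ_{x∈Λ} 1_A(T_x ω) − P(A))² dP = |Λ|⁻² Σ_{x,y∈Λ} (P(A ∩ T_{y−x}⁻¹A) − P(A)²)`;
* **`tendsto_integral_sq_avg_indicator_sub`** — if `P(A ∩ T_v⁻¹ A) → P(A)²` as `v → ∞` (cofinite filter on `G`) then
  `∫ (|Λ_i|⁻¹ Σ_{x∈Λ_i} 1_A ∘ T_x − P(A))² dP → 0`; **`tendsto_integral_abs_avg_indicator_sub`** (the `L¹` form, via
  `tendsto_integral_abs_of_sq`); `tendsto_measureReal_le_abs_of_integral` (`L¹ ⇒` in probability, Markov);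
* **`tendsto_integral_abs_avg_sub_integral`** — `∫ | |Λ_i|⁻¹ Σ_{x∈Λ_i} f(T_x ω) − ∫ f dP | dP → 0` for every bounded
  measurable `f` approximable in `L¹(P)` by finite combinations `Σ_k c_k 1_{B_k}` of such self-mixing events `B_k`.

## References

* G. Grimmett, *The Random-Cluster Model*, Springer 2006 (`book:grimmett2006-random-cluster-model`): §4.3
  Thm. (4.19)(b),(d), Cor. (4.23) (mixing ⇒ ergodicity) [PDF pp. 77–79]; §4.5 (4.83) [PDF p. 94]. [Grimmett2006]
-/

noncomputable section

open MeasureTheory ProbabilityTheory Filter Finset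
open scoped Topology ENNReal

namespace Summit.CriticalPhenomena.PercolationContinuityZ3.Theorems.FK

section Generic

variable {Ω : Type*} [MeasurableSpace Ω] {G : Type*} [AddCommGroup G] {P : Measure Ω} {T : G → Ω → Ω}

/-! ### Translates of one event under an invariant action -/

omit [MeasurableSpace Ω] in
/-- Pull-backs compose: `T_v⁻¹(T_w⁻¹ A) = T_{v+w}⁻¹ A` when `T_w ∘ T_v = T_{v+w}`. [folklore] -/
theorem preimage_preimage_eq_preimage_add (hTT : ∀ v w ω, T w (T v ω) = T (v + w) ω) (v w : G) (A : Set Ω) :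
    T v ⁻¹' (T w ⁻¹' A) = T (v + w) ⁻¹' A := by
  ext ω
  simp only [Set.mem_preimage, hTT]

/-- **`P(T_x⁻¹A ∩ T_y⁻¹A) = P(A ∩ T_{y−x}⁻¹A)`** for a `P`-preserving action. [cite: Grimmett2006, Thm. (4.19)(b)] -/
theorem measureReal_preimage_inter_preimage (hT : ∀ v, Measurable (T v))
    (hTT : ∀ v w ω, T w (T v ω) = T (v + w) ω) (hinv : ∀ v, MeasurePreserving (T v) P P)
    {A : Set Ω} (hA : MeasurableSet A) (x y : G) :
    P.real (T x ⁻¹' A ∩ T y ⁻¹' A) = P.real (A ∩ T (y - x) ⁻¹' A) := by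
  have h : T y ⁻¹' A = T x ⁻¹' (T (y - x) ⁻¹' A) := by
    rw [preimage_preimage_eq_preimage_add hTT, add_comm, sub_add_cancel]
  rw [h, ← Set.preimage_inter, measureReal_def, measureReal_def,
    (hinv x).measure_preimage (hA.inter ((hT _) hA)).nullMeasurableSet]

/-! ### The double-sum estimate -/

/-- **`|Σ_{x∈Λ} Σ_{y∈Λ} c(y − x)| ≤ |Λ| (|V| M + |Λ| ε)`** if `|c| ≤ M` everywhere and `|c| ≤ ε` off the finite set `V`
(for fixed `x`, `y ↦ y − x` is injective, so at most `|V|` of the `y ∈ Λ` have `y − x ∈ V`). [folklore] -/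
theorem abs_sum_sum_sub_le_card_mul {c : G → ℝ} {M ε : ℝ} (hM : ∀ v, |c v| ≤ M) (V : Finset G)
    (hV : ∀ v ∉ V, |c v| ≤ ε) (hε : 0 ≤ ε) (Λ : Finset G) :
    |∑ x ∈ Λ, ∑ y ∈ Λ, c (y - x)| ≤ #Λ * (#V * M + #Λ * ε) := by
  classical
  have hM0 : 0 ≤ M := (abs_nonneg _).trans (hM 0)
  have hx : ∀ x ∈ Λ, |∑ y ∈ Λ, c (y - x)| ≤ #V * M + #Λ * ε := by
    intro x _
    calc |∑ y ∈ Λ, c (y - x)| ≤ ∑ y ∈ Λ, |c (y - x)| := Finset.abs_sum_le_sum_abs _ _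
      _ = ∑ y ∈ Λ with y - x ∈ V, |c (y - x)| + ∑ y ∈ Λ with ¬ (y - x ∈ V), |c (y - x)| :=
          (Finset.sum_filter_add_sum_filter_not _ _ _).symm
      _ ≤ ∑ y ∈ Λ with y - x ∈ V, M + ∑ y ∈ Λ with ¬ (y - x ∈ V), ε := by
          gcongr with y hy y hy
          · exact hM _
          · exact hV _ (Finset.mem_filter.1 hy).2
      _ ≤ #V * M + #Λ * ε := by
          rw [Finset.sum_const, Finset.sum_const, nsmul_eq_mul, nsmul_eq_mul]
          have h1 : (#(Λ.filter fun y => y - x ∈ V) : ℝ) ≤ #V := by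
            exact_mod_cast Finset.card_le_card_of_injOn (fun y => y - x) (fun y hy => (Finset.mem_filter.1 hy).2)
              (fun y _ y' _ h => sub_left_injective h)
          have h2 : (#(Λ.filter fun y => ¬ (y - x ∈ V)) : ℝ) ≤ #Λ := by exact_mod_cast Finset.card_filter_le _ _
          exact add_le_add (mul_le_mul_of_nonneg_right h1 hM0) (mul_le_mul_of_nonneg_right h2 hε)
  calc |∑ x ∈ Λ, ∑ y ∈ Λ, c (y - x)| ≤ ∑ x ∈ Λ, |∑ y ∈ Λ, c (y - x)| := Finset.abs_sum_le_sum_abs _ _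
    _ ≤ ∑ x ∈ Λ, (#V * M + #Λ * ε) := Finset.sum_le_sum hx
    _ = #Λ * (#V * M + #Λ * ε) := by rw [Finset.sum_const, nsmul_eq_mul]

/-! ### The variance of a translation average of an indicator -/

variable [IsProbabilityMeasure P]

omit [AddCommGroup G] in
/-- The translate indicator `1_{T_x⁻¹A}` is square integrable. [folklore] -/
theorem memLp_two_indicator_preimage (hT : ∀ v, Measurable (T v)) {A : Set Ω} (hA : MeasurableSet A) (x : G) :
    MemLp ((T x ⁻¹' A).indicator (1 : Ω → ℝ)) 2 P :=
  MemLp.of_bound ((measurable_const.indicator ((hT x) hA)).aestronglyMeasurable) 1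
    (Eventually.of_forall fun _ => (norm_indicator_le_norm_self _ _).trans norm_one.le)

omit [AddCommGroup G] [IsProbabilityMeasure P] in
/-- `∫ 1_{T_x⁻¹A} dP = P(A)` by invariance. [cite: Grimmett2006, Thm. (4.19)(b)] -/
theorem integral_indicator_preimage_eq (hT : ∀ v, Measurable (T v)) (hinv : ∀ v, MeasurePreserving (T v) P P)
    {A : Set Ω} (hA : MeasurableSet A) (x : G) :
    ∫ ω, (T x ⁻¹' A).indicator (1 : Ω → ℝ) ω ∂P = P.real A := by
  rw [integral_indicator_one ((hT x) hA), measureReal_def, measureReal_def,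
    (hinv x).measure_preimage hA.nullMeasurableSet]

/-- The covariance of two translates: `cov(1_{T_x⁻¹A}, 1_{T_y⁻¹A}) = P(A ∩ T_{y−x}⁻¹A) − P(A)²`.
[cite: Grimmett2006, Thm. (4.19)(b)] -/
theorem covariance_indicator_preimage (hT : ∀ v, Measurable (T v))
    (hTT : ∀ v w ω, T w (T v ω) = T (v + w) ω) (hinv : ∀ v, MeasurePreserving (T v) P P)
    {A : Set Ω} (hA : MeasurableSet A) (x y : G) :
    cov[(T x ⁻¹' A).indicator (1 : Ω → ℝ), (T y ⁻¹' A).indicator (1 : Ω → ℝ); P] =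
      P.real (A ∩ T (y - x) ⁻¹' A) - P.real A ^ 2 := by
  rw [covariance_eq_sub (memLp_two_indicator_preimage hT hA x) (memLp_two_indicator_preimage hT hA y),
    ← Set.inter_indicator_one, integral_indicator_one (((hT x) hA).inter ((hT y) hA)),
    measureReal_preimage_inter_preimage hT hTT hinv hA, integral_indicator_preimage_eq hT hinv hA,
    integral_indicator_preimage_eq hT hinv hA, sq]

omit [AddCommGroup G] in
/-- The mean of a translation average of `1_A` is `P(A)`. [cite: Grimmett2006, Thm. (4.19)(b)] -/
theorem integral_avg_indicator_eq (hT : ∀ v, Measurable (T v)) (hinv : ∀ v, MeasurePreserving (T v) P P)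
    {A : Set Ω} (hA : MeasurableSet A) {Λ : Finset G} (hΛ : Λ.Nonempty) :
    ∫ ω, (#Λ : ℝ)⁻¹ * ∑ x ∈ Λ, (T x ⁻¹' A).indicator (1 : Ω → ℝ) ω ∂P = P.real A := by
  have hcard : (#Λ : ℝ) ≠ 0 := by exact_mod_cast hΛ.card_pos.ne'
  rw [integral_const_mul, integral_finsetSum _ fun x _ => (memLp_two_indicator_preimage hT hA x).integrable one_le_two]
  simp_rw [integral_indicator_preimage_eq hT hinv hA]
  rw [Finset.sum_const, nsmul_eq_mul, ← mul_assoc, inv_mul_cancel₀ hcard, one_mul]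

/-- **The variance identity**: `∫ (|Λ|⁻¹ Σ_{x∈Λ} 1_A(T_x ω) − P(A))² dP = |Λ|⁻² Σ_{x,y∈Λ} (P(A ∩ T_{y−x}⁻¹A) − P(A)²)`.
[cite: Grimmett2006, Cor. (4.23)] -/
theorem integral_sq_avg_indicator_sub_eq (hT : ∀ v, Measurable (T v))
    (hTT : ∀ v w ω, T w (T v ω) = T (v + w) ω) (hinv : ∀ v, MeasurePreserving (T v) P P)
    {A : Set Ω} (hA : MeasurableSet A) {Λ : Finset G} (hΛ : Λ.Nonempty) :
    ∫ ω, ((#Λ : ℝ)⁻¹ * ∑ x ∈ Λ, (T x ⁻¹' A).indicator (1 : Ω → ℝ) ω - P.real A) ^ 2 ∂P =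
      ((#Λ : ℝ)⁻¹) ^ 2 * ∑ x ∈ Λ, ∑ y ∈ Λ, (P.real (A ∩ T (y - x) ⁻¹' A) - P.real A ^ 2) := by
  have hYm : AEMeasurable (fun ω => (#Λ : ℝ)⁻¹ * ∑ x ∈ Λ, (T x ⁻¹' A).indicator (1 : Ω → ℝ) ω) P :=
    ((Finset.measurable_sum Λ fun x _ => measurable_const.indicator ((hT x) hA)).const_mul _).aemeasurable
  have hvar := variance_eq_integral hYm
  rw [integral_avg_indicator_eq hT hinv hA hΛ] at hvar
  rw [← hvar, variance_const_mul, variance_fun_sum' fun x _ => memLp_two_indicator_preimage hT hA x]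
  simp_rw [covariance_indicator_preimage hT hTT hinv hA]

/-! ### The `L²` law of large numbers from self-mixing along `v → ∞` -/

/-- **`L²` law of large numbers for translation averages.** If `P(A ∩ T_v⁻¹A) → P(A)²` as `v → ∞` (cofinite filter)
then `∫ (|Λ_i|⁻¹ Σ_{x∈Λ_i} 1_A(T_x ω) − P(A))² dP → 0` along every family of finite sets with `|Λ_i| → ∞`.
[cite: Grimmett2006, Cor. (4.23) with §4.5 (4.83)] -/
theorem tendsto_integral_sq_avg_indicator_sub (hT : ∀ v, Measurable (T v))
    (hTT : ∀ v w ω, T w (T v ω) = T (v + w) ω) (hinv : ∀ v, MeasurePreserving (T v) P P)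
    {A : Set Ω} (hA : MeasurableSet A)
    (hmix : Tendsto (fun v => P.real (A ∩ T v ⁻¹' A)) cofinite (𝓝 (P.real A ^ 2)))
    {ι : Type*} {l : Filter ι} {Λ : ι → Finset G} (hΛ : Tendsto (fun i => (#(Λ i) : ℝ)) l atTop) :
    Tendsto (fun i => ∫ ω, ((#(Λ i) : ℝ)⁻¹ * ∑ x ∈ Λ i, (T x ⁻¹' A).indicator (1 : Ω → ℝ) ω - P.real A) ^ 2 ∂P)
      l (𝓝 0) := by
  rw [Metric.tendsto_nhds]
  intro ε hε
  set c : G → ℝ := fun v => P.real (A ∩ T v ⁻¹' A) - P.real A ^ 2 with hc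
  have hc0 : Tendsto c cofinite (𝓝 0) := by rw [← sub_self (P.real A ^ 2)]; exact hmix.sub_const _
  have hcM : ∀ v, |c v| ≤ 1 := fun v => by
    have h1 : P.real (A ∩ T v ⁻¹' A) ≤ 1 := measureReal_le_one
    have h2 : 0 ≤ P.real (A ∩ T v ⁻¹' A) := measureReal_nonneg
    have h3 : P.real A ^ 2 ≤ 1 := pow_le_one₀ measureReal_nonneg measureReal_le_one
    rw [hc, abs_le]; constructor <;> nlinarith [sq_nonneg (P.real A)]
  have hfin : Set.Finite {v | ¬ |c v| < ε / 3} := by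
    have h := (Metric.tendsto_nhds.1 hc0) (ε / 3) (by positivity)
    simp_rw [Real.dist_eq, sub_zero] at h
    exact Filter.eventually_cofinite.1 h
  set V := hfin.toFinset with hV
  have hcV : ∀ v ∉ V, |c v| ≤ ε / 3 := fun v hv => by
    have h : ¬¬ |c v| < ε / 3 := fun h' => hv (hfin.mem_toFinset.2 h')
    exact (not_not.1 h).le
  filter_upwards [hΛ.eventually_ge_atTop (max 1 (3 * #V / ε))] with i hi
  have hcard : 0 < (#(Λ i) : ℝ) := one_pos.trans_le ((le_max_left _ _).trans hi)
  have hne : (Λ i).Nonempty := by rw [← Finset.card_pos]; exact_mod_cast hcard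
  rw [Real.dist_eq, sub_zero, integral_sq_avg_indicator_sub_eq hT hTT hinv hA hne]
  have hS := abs_sum_sum_sub_le_card_mul hcM V hcV (by positivity) (Λ i)
  have hVle : (#V : ℝ) * 1 ≤ #(Λ i) * (ε / 3) := by
    have := (le_max_right _ _).trans hi
    rw [div_le_iff₀ hε] at this; linarith
  rw [abs_mul, abs_of_nonneg (sq_nonneg _), inv_pow, ← div_eq_inv_mul, div_lt_iff₀ (by positivity)]
  calc |∑ x ∈ Λ i, ∑ y ∈ Λ i, c (y - x)| ≤ #(Λ i) * (#V * 1 + #(Λ i) * (ε / 3)) := hS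
    _ ≤ #(Λ i) * (#(Λ i) * (ε / 3) + #(Λ i) * (ε / 3)) := by gcongr
    _ < ε * (#(Λ i) : ℝ) ^ 2 := by nlinarith [mul_pos (mul_pos hε hcard) hcard]

/-! ### From `L²` to `L¹` and to convergence in probability -/

/-- `L² ⇒ L¹` on a probability space: if `∫ g_i² dP → 0` for square-integrable `g_i` then `∫ |g_i| dP → 0`
(pointwise `|t| ≤ δ/2 + t²/(2δ)`). [folklore] -/
theorem tendsto_integral_abs_of_sq {ι : Type*} {l : Filter ι} {g : ι → Ω → ℝ} (hg : ∀ i, MemLp (g i) 2 P)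
    (h2 : Tendsto (fun i => ∫ ω, g i ω ^ 2 ∂P) l (𝓝 0)) :
    Tendsto (fun i => ∫ ω, |g i ω| ∂P) l (𝓝 0) := by
  rw [Metric.tendsto_nhds]
  intro ε hε
  filter_upwards [(Metric.tendsto_nhds.1 h2) (ε ^ 2 / 2) (by positivity)] with i hi
  have hint2 : Integrable (fun ω => g i ω ^ 2) P := (hg i).integrable_sq
  have hint1 : Integrable (fun ω => |g i ω|) P := ((hg i).integrable one_le_two).abs
  have hpt : ∀ ω, |g i ω| ≤ ε / 2 + g i ω ^ 2 / (2 * ε) := fun ω => by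
    have h' : 2 * ε * |g i ω| ≤ ε ^ 2 + g i ω ^ 2 := by
      nlinarith [sq_nonneg (|g i ω| - ε), sq_abs (g i ω)]
    have h2ε : (0 : ℝ) < 2 * ε := by positivity
    calc |g i ω| = (2 * ε * |g i ω|) / (2 * ε) := (mul_div_cancel_left₀ _ h2ε.ne').symm
      _ ≤ (ε ^ 2 + g i ω ^ 2) / (2 * ε) := by gcongr
      _ = ε / 2 + g i ω ^ 2 / (2 * ε) := by field_simp
  rw [Real.dist_eq, sub_zero] at hi ⊢
  rw [abs_of_nonneg (integral_nonneg fun ω => sq_nonneg _)] at hi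
  rw [abs_of_nonneg (integral_nonneg fun ω => abs_nonneg _)]
  calc ∫ ω, |g i ω| ∂P ≤ ∫ ω, (ε / 2 + g i ω ^ 2 / (2 * ε)) ∂P :=
        integral_mono hint1 ((integrable_const _).add (hint2.div_const _)) hpt
    _ = ε / 2 + (∫ ω, g i ω ^ 2 ∂P) / (2 * ε) := by
        rw [integral_add (integrable_const _) (hint2.div_const _), integral_const, smul_eq_mul, probReal_univ,
          one_mul, integral_div]
    _ < ε / 2 + (ε ^ 2 / 2) / (2 * ε) := by gcongr
    _ = ε / 2 + ε / 4 := by field_simp; ring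
    _ < ε := by linarith

omit [IsProbabilityMeasure P] in
/-- `L¹ ⇒` in probability (Markov's inequality): if `∫ |g_i| dP → 0` then `P(|g_i| ≥ δ) → 0` for every `δ > 0`.
[folklore] -/
theorem tendsto_measureReal_le_abs_of_integral {ι : Type*} {l : Filter ι} {g : ι → Ω → ℝ}
    (hg : ∀ i, Integrable (g i) P) (h1 : Tendsto (fun i => ∫ ω, |g i ω| ∂P) l (𝓝 0)) {δ : ℝ} (hδ : 0 < δ) :
    Tendsto (fun i => P.real {ω | δ ≤ |g i ω|}) l (𝓝 0) := by
  have h0 : Tendsto (fun i => (∫ ω, |g i ω| ∂P) / δ) l (𝓝 0) := by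
    have h := h1.div_const δ; rwa [zero_div] at h
  refine squeeze_zero (fun i => measureReal_nonneg (μ := P)) (fun i => ?_) h0
  rw [le_div_iff₀ hδ, mul_comm]
  exact mul_meas_ge_le_integral_of_nonneg (Eventually.of_forall fun ω => abs_nonneg _) (hg i).abs δ

/-- **`L¹` law of large numbers for translation averages of `1_A`**: `∫ | |Λ_i|⁻¹ Σ_{x∈Λ_i} 1_A(T_x ω) − P(A) | dP → 0`.
[cite: Grimmett2006, Cor. (4.23) with §4.5 (4.83)] -/
theorem tendsto_integral_abs_avg_indicator_sub (hT : ∀ v, Measurable (T v))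
    (hTT : ∀ v w ω, T w (T v ω) = T (v + w) ω) (hinv : ∀ v, MeasurePreserving (T v) P P)
    {A : Set Ω} (hA : MeasurableSet A)
    (hmix : Tendsto (fun v => P.real (A ∩ T v ⁻¹' A)) cofinite (𝓝 (P.real A ^ 2)))
    {ι : Type*} {l : Filter ι} {Λ : ι → Finset G} (hΛ : Tendsto (fun i => (#(Λ i) : ℝ)) l atTop) :
    Tendsto (fun i => ∫ ω, |(#(Λ i) : ℝ)⁻¹ * ∑ x ∈ Λ i, (T x ⁻¹' A).indicator (1 : Ω → ℝ) ω - P.real A| ∂P)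
      l (𝓝 0) := by
  refine tendsto_integral_abs_of_sq (fun i => ?_) (tendsto_integral_sq_avg_indicator_sub hT hTT hinv hA hmix hΛ)
  have h : MemLp (fun ω => (#(Λ i) : ℝ)⁻¹ * ∑ x ∈ Λ i, (T x ⁻¹' A).indicator (1 : Ω → ℝ) ω - P.real A) 2 P :=
    ((memLp_finsetSum _ fun x _ => memLp_two_indicator_preimage hT hA x).const_mul _).sub (memLp_const (P.real A))
  exact h

/-! ### The `L¹` law of large numbers for approximable observables -/

omit [AddCommGroup G] [IsProbabilityMeasure P] in
/-- `∫ f ∘ T_x dP = ∫ f dP` for a `P`-preserving action. [cite: Grimmett2006, Thm. (4.19)(b)] -/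
theorem integral_comp_eq_of_forall_measurePreserving (hinv : ∀ v, MeasurePreserving (T v) P P) {f : Ω → ℝ}
    (hf : AEStronglyMeasurable f P) (x : G) : ∫ ω, f (T x ω) ∂P = ∫ ω, f ω ∂P := by
  have hf' : AEStronglyMeasurable f (P.map (T x)) := by rw [(hinv x).map_eq]; exact hf
  rw [← integral_map (hinv x).measurable.aemeasurable hf', (hinv x).map_eq]

/-- **`L¹` law of large numbers for translation averages of an approximable observable.** Let `f` be bounded and
measurable, and suppose that for every `ε > 0` there is a finite combination `g = Σ_{k∈t} c_k 1_{B_k}` of measurable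
events `B_k`, each self-mixing along `v → ∞` (`P(B_k ∩ T_v⁻¹B_k) → P(B_k)²`), with `∫ |f − g| dP ≤ ε`. Then
`∫ | |Λ_i|⁻¹ Σ_{x∈Λ_i} f(T_x ω) − ∫ f dP | dP → 0` along every family of finite sets with `|Λ_i| → ∞`.
[cite: Grimmett2006, Cor. (4.23) with §4.5 (4.83)] -/
theorem tendsto_integral_abs_avg_sub_integral (hT : ∀ v, Measurable (T v))
    (hTT : ∀ v w ω, T w (T v ω) = T (v + w) ω) (hinv : ∀ v, MeasurePreserving (T v) P P)
    {f : Ω → ℝ} (hfm : Measurable f) {M : ℝ} (hfM : ∀ ω, |f ω| ≤ M)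
    (happrox : ∀ ε > 0, ∃ (t : Finset ℕ) (c : ℕ → ℝ) (B : ℕ → Set Ω),
      (∀ k ∈ t, MeasurableSet (B k) ∧ Tendsto (fun v => P.real (B k ∩ T v ⁻¹' B k)) cofinite (𝓝 (P.real (B k) ^ 2))) ∧
      ∫ ω, |f ω - ∑ k ∈ t, c k * (B k).indicator (1 : Ω → ℝ) ω| ∂P ≤ ε)
    {ι : Type*} {l : Filter ι} {Λ : ι → Finset G} (hΛ : Tendsto (fun i => (#(Λ i) : ℝ)) l atTop) :
    Tendsto (fun i => ∫ ω, |(#(Λ i) : ℝ)⁻¹ * ∑ x ∈ Λ i, f (T x ω) - ∫ ω', f ω' ∂P| ∂P) l (𝓝 0) := by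
  rw [Metric.tendsto_nhds]
  intro ε hε
  obtain ⟨t, c, B, hs, hfg⟩ := happrox (ε / 4) (by positivity)
  -- the approximant and its translation averages
  set g : Ω → ℝ := fun ω => ∑ k ∈ t, c k * (B k).indicator (1 : Ω → ℝ) ω with hg
  have hBm : ∀ k ∈ t, MeasurableSet (B k) := fun k hk => (hs k hk).1
  have hgm : Measurable g := Finset.measurable_sum t fun k hk => (measurable_const.indicator (hBm k hk)).const_mul _
  have hfi : Integrable f P := Integrable.of_bound hfm.aestronglyMeasurable M (Eventually.of_forall fun ω => by
    rw [Real.norm_eq_abs]; exact hfM ω)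
  have hfTi : ∀ x, Integrable (fun ω => f (T x ω)) P := fun x =>
    Integrable.of_bound (hfm.comp (hT x)).aestronglyMeasurable M (Eventually.of_forall fun ω => by
      rw [Real.norm_eq_abs]; exact hfM _)
  -- `g` is bounded by `Σ |c_k|`
  have hgb : ∀ ω, |g ω| ≤ ∑ k ∈ t, |c k| := fun ω => by
    refine (Finset.abs_sum_le_sum_abs _ _).trans (Finset.sum_le_sum fun k _ => ?_)
    rw [abs_mul]
    exact mul_le_of_le_one_right (abs_nonneg _)
      ((Real.norm_eq_abs _).symm.trans_le ((norm_indicator_le_norm_self _ _).trans norm_one.le))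
  have hgi : Integrable g P := Integrable.of_bound hgm.aestronglyMeasurable _ (Eventually.of_forall fun ω => by
    rw [Real.norm_eq_abs]; exact hgb ω)
  have hgTi : ∀ x, Integrable (fun ω => g (T x ω)) P := fun x =>
    Integrable.of_bound (hgm.comp (hT x)).aestronglyMeasurable _ (Eventually.of_forall fun ω => by
      rw [Real.norm_eq_abs]; exact hgb _)
  -- the indicator averages converge in `L¹`, hence so does their combination
  have hlim : Tendsto (fun i => ∑ k ∈ t, |c k| *
      ∫ ω, |(#(Λ i) : ℝ)⁻¹ * ∑ x ∈ Λ i, (T x ⁻¹' B k).indicator (1 : Ω → ℝ) ω - P.real (B k)| ∂P) l (𝓝 0) := by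
    have h := tendsto_finsetSum t fun k hk =>
      (tendsto_integral_abs_avg_indicator_sub hT hTT hinv (hs k hk).1 (hs k hk).2 hΛ).const_mul |c k|
    simpa using h
  filter_upwards [(Metric.tendsto_nhds.1 hlim) (ε / 4) (by positivity), hΛ.eventually_ge_atTop 1] with i hi hcard1
  have hcard : 0 < (#(Λ i) : ℝ) := one_pos.trans_le hcard1
  rw [Real.dist_eq, sub_zero, abs_of_nonneg (Finset.sum_nonneg fun k _ => mul_nonneg (abs_nonneg _)
    (integral_nonneg fun ω => abs_nonneg _))] at hi
  rw [Real.dist_eq, sub_zero, abs_of_nonneg (integral_nonneg fun ω => abs_nonneg _)]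
  -- pointwise decomposition `avg f − ∫ f = (avg f − avg g) + (avg g − Σ c_k P(B_k)) + (Σ c_k P(B_k) − ∫ f)`
  have hdecomp : ∀ ω, (#(Λ i) : ℝ)⁻¹ * ∑ x ∈ Λ i, f (T x ω) - ∫ ω', f ω' ∂P =
      ((#(Λ i) : ℝ)⁻¹ * ∑ x ∈ Λ i, (f (T x ω) - g (T x ω))) +
      (∑ k ∈ t, c k * ((#(Λ i) : ℝ)⁻¹ * ∑ x ∈ Λ i, (T x ⁻¹' B k).indicator (1 : Ω → ℝ) ω - P.real (B k))) +
      (∑ k ∈ t, c k * P.real (B k) - ∫ ω', f ω' ∂P) := fun ω => by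
    have hgT : ∀ x, g (T x ω) = ∑ k ∈ t, c k * (T x ⁻¹' B k).indicator (1 : Ω → ℝ) ω := fun x => rfl
    have h1 : ∑ x ∈ Λ i, g (T x ω) = ∑ k ∈ t, c k * ∑ x ∈ Λ i, (T x ⁻¹' B k).indicator (1 : Ω → ℝ) ω := by
      simp_rw [hgT]; rw [Finset.sum_comm]; simp_rw [Finset.mul_sum]
    have h2 : ∑ k ∈ t, c k * ((#(Λ i) : ℝ)⁻¹ * ∑ x ∈ Λ i, (T x ⁻¹' B k).indicator (1 : Ω → ℝ) ω - P.real (B k)) =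
        (#(Λ i) : ℝ)⁻¹ * ∑ x ∈ Λ i, g (T x ω) - ∑ k ∈ t, c k * P.real (B k) := by
      rw [h1, Finset.mul_sum, ← Finset.sum_sub_distrib]
      exact Finset.sum_congr rfl fun k _ => by ring
    rw [h2, Finset.sum_sub_distrib, mul_sub]; ring
  -- the three `L¹` bounds
  have hI1 : ∫ ω, |(#(Λ i) : ℝ)⁻¹ * ∑ x ∈ Λ i, (f (T x ω) - g (T x ω))| ∂P ≤ ε / 4 := by
    have hle : ∀ ω, |(#(Λ i) : ℝ)⁻¹ * ∑ x ∈ Λ i, (f (T x ω) - g (T x ω))| ≤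
        (#(Λ i) : ℝ)⁻¹ * ∑ x ∈ Λ i, |f (T x ω) - g (T x ω)| := fun ω => by
      rw [abs_mul, abs_of_nonneg (inv_nonneg.2 (Nat.cast_nonneg _))]
      exact mul_le_mul_of_nonneg_left (Finset.abs_sum_le_sum_abs _ _) (inv_nonneg.2 (Nat.cast_nonneg _))
    have hint : ∀ x, Integrable (fun ω => |f (T x ω) - g (T x ω)|) P := fun x => ((hfTi x).sub (hgTi x)).abs
    calc ∫ ω, |(#(Λ i) : ℝ)⁻¹ * ∑ x ∈ Λ i, (f (T x ω) - g (T x ω))| ∂P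
        ≤ ∫ ω, (#(Λ i) : ℝ)⁻¹ * ∑ x ∈ Λ i, |f (T x ω) - g (T x ω)| ∂P :=
          integral_mono_of_nonneg (Eventually.of_forall fun ω => abs_nonneg _)
            ((integrable_finsetSum _ fun x _ => hint x).const_mul _) (Eventually.of_forall hle)
      _ = (#(Λ i) : ℝ)⁻¹ * ∑ x ∈ Λ i, ∫ ω, |f ω - g ω| ∂P := by
          rw [integral_const_mul, integral_finsetSum _ fun x _ => hint x]
          congr 1
          exact Finset.sum_congr rfl fun x _ =>
            integral_comp_eq_of_forall_measurePreserving hinv (f := fun ω => |f ω - g ω|)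
              ((hfm.sub hgm).norm.aestronglyMeasurable) x
      _ = ∫ ω, |f ω - g ω| ∂P := by
          rw [Finset.sum_const, nsmul_eq_mul, ← mul_assoc, inv_mul_cancel₀ hcard.ne', one_mul]
      _ ≤ ε / 4 := hfg
  have hI2 : ∫ ω, |∑ k ∈ t, c k * ((#(Λ i) : ℝ)⁻¹ * ∑ x ∈ Λ i, (T x ⁻¹' B k).indicator (1 : Ω → ℝ) ω - P.real (B k))| ∂P
      ≤ ∑ k ∈ t, |c k| * ∫ ω, |(#(Λ i) : ℝ)⁻¹ * ∑ x ∈ Λ i, (T x ⁻¹' B k).indicator (1 : Ω → ℝ) ω - P.real (B k)| ∂P := by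
    have hintB : ∀ k ∈ t, Integrable (fun ω =>
        |c k| * |(#(Λ i) : ℝ)⁻¹ * ∑ x ∈ Λ i, (T x ⁻¹' B k).indicator (1 : Ω → ℝ) ω - P.real (B k)|) P := fun k hk =>
      ((((integrable_finsetSum _ fun x _ => (memLp_two_indicator_preimage hT (hBm k hk) x).integrable
        one_le_two).const_mul _).sub (integrable_const _))).abs.const_mul _
    calc ∫ ω, |∑ k ∈ t, c k * ((#(Λ i) : ℝ)⁻¹ * ∑ x ∈ Λ i, (T x ⁻¹' B k).indicator (1 : Ω → ℝ) ω - P.real (B k))| ∂P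
        ≤ ∫ ω, ∑ k ∈ t, |c k| * |(#(Λ i) : ℝ)⁻¹ * ∑ x ∈ Λ i, (T x ⁻¹' B k).indicator (1 : Ω → ℝ) ω - P.real (B k)| ∂P := by
          refine integral_mono_of_nonneg (Eventually.of_forall fun ω => abs_nonneg _)
            (integrable_finsetSum _ hintB) (Eventually.of_forall fun ω => ?_)
          refine (Finset.abs_sum_le_sum_abs _ _).trans (le_of_eq (Finset.sum_congr rfl fun k _ => abs_mul _ _))
      _ = ∑ k ∈ t, |c k| * ∫ ω, |(#(Λ i) : ℝ)⁻¹ * ∑ x ∈ Λ i, (T x ⁻¹' B k).indicator (1 : Ω → ℝ) ω - P.real (B k)| ∂P := by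
          rw [integral_finsetSum _ hintB]
          exact Finset.sum_congr rfl fun k _ => integral_const_mul _ _
  have hI3 : |∑ k ∈ t, c k * P.real (B k) - ∫ ω', f ω' ∂P| ≤ ε / 4 := by
    have hgint : ∫ ω, g ω ∂P = ∑ k ∈ t, c k * P.real (B k) := by
      have hint : ∀ k ∈ t, Integrable (fun ω => c k * (B k).indicator (1 : Ω → ℝ) ω) P := fun k hk =>
        ((integrable_const (1 : ℝ)).indicator (hBm k hk)).const_mul (c k)
      simp only [hg]
      rw [integral_finsetSum _ hint]
      exact Finset.sum_congr rfl fun k hk => by rw [integral_const_mul, integral_indicator_one (hBm k hk)]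
    rw [← hgint, ← integral_sub hgi hfi]
    calc |∫ ω, g ω - f ω ∂P| ≤ ∫ ω, |g ω - f ω| ∂P := abs_integral_le_integral_abs
      _ = ∫ ω, |f ω - g ω| ∂P := by simp_rw [abs_sub_comm (g _) (f _)]
      _ ≤ ε / 4 := hfg
  -- assemble
  have hintA : Integrable (fun ω => (#(Λ i) : ℝ)⁻¹ * ∑ x ∈ Λ i, (f (T x ω) - g (T x ω))) P :=
    (integrable_finsetSum _ fun x _ => (hfTi x).sub (hgTi x)).const_mul _
  have hintBsum : Integrable (fun ω => ∑ k ∈ t, c k *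
      ((#(Λ i) : ℝ)⁻¹ * ∑ x ∈ Λ i, (T x ⁻¹' B k).indicator (1 : Ω → ℝ) ω - P.real (B k))) P :=
    integrable_finsetSum _ fun k hk => (((integrable_finsetSum _ fun x _ =>
      (memLp_two_indicator_preimage hT (hBm k hk) x).integrable one_le_two).const_mul _).sub (integrable_const _)).const_mul _
  calc ∫ ω, |(#(Λ i) : ℝ)⁻¹ * ∑ x ∈ Λ i, f (T x ω) - ∫ ω', f ω' ∂P| ∂P
      = ∫ ω, |((#(Λ i) : ℝ)⁻¹ * ∑ x ∈ Λ i, (f (T x ω) - g (T x ω))) +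
          (∑ k ∈ t, c k * ((#(Λ i) : ℝ)⁻¹ * ∑ x ∈ Λ i, (T x ⁻¹' B k).indicator (1 : Ω → ℝ) ω - P.real (B k))) +
          (∑ k ∈ t, c k * P.real (B k) - ∫ ω', f ω' ∂P)| ∂P := by simp_rw [hdecomp]
    _ ≤ ∫ ω, (|(#(Λ i) : ℝ)⁻¹ * ∑ x ∈ Λ i, (f (T x ω) - g (T x ω))| +
          |∑ k ∈ t, c k * ((#(Λ i) : ℝ)⁻¹ * ∑ x ∈ Λ i, (T x ⁻¹' B k).indicator (1 : Ω → ℝ) ω - P.real (B k))| +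
          |∑ k ∈ t, c k * P.real (B k) - ∫ ω', f ω' ∂P|) ∂P := by
        refine integral_mono_of_nonneg (Eventually.of_forall fun ω => abs_nonneg _)
          ((hintA.abs.add hintBsum.abs).add (integrable_const _)) (Eventually.of_forall fun ω => ?_)
        exact (abs_add_le _ _).trans (add_le_add (abs_add_le _ _) le_rfl)
    _ = ∫ ω, |(#(Λ i) : ℝ)⁻¹ * ∑ x ∈ Λ i, (f (T x ω) - g (T x ω))| ∂P +
          ∫ ω, |∑ k ∈ t, c k * ((#(Λ i) : ℝ)⁻¹ * ∑ x ∈ Λ i, (T x ⁻¹' B k).indicator (1 : Ω → ℝ) ω - P.real (B k))| ∂P +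
          |∑ k ∈ t, c k * P.real (B k) - ∫ ω', f ω' ∂P| := by
        have hAB := hintA.abs.add hintBsum.abs
        simp only [Pi.add_def] at hAB
        rw [integral_add hAB (integrable_const _), integral_add hintA.abs hintBsum.abs,
          integral_const, smul_eq_mul, probReal_univ, one_mul]
    _ < ε := by linarith [hI1, hI2, hI3, hi]

end Generic

end Summit.CriticalPhenomena.PercolationContinuityZ3.Theorems.FK

end
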